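import Literature.Probability.Percolation.MarkedLoopBoundarySpanNested
import HarnessLib

/-!
# Boundary span from a FINITE nested chain: expansions are needed only up to the dimension («BSPAN-NESTED-FINITE»)

Topic `Literature/Probability/Percolation`; generic-`k` layer of the marked-loop (Khristoforov–Smirnov) lineage; a rider on `MarkedLoopBoundarySpanNested.lean`
(«BSPAN-NESTED-CRITERION», ★★★ `bNonvanish_of_nested_stable_corners`: a monotone chain of families `T 0 ⊆ T 1 ⊆ ⋯` of home-arc lawpoints in which every member of
`T i` expands, under every corner-pair generator `e_j`, into the span of the laws of `T (i+1)`, FOR EVERY `i`, gives `BNonvanish`).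

WHY. The chain the surgery calculus can actually supply is a chain of families with a DECREASING ROOM PARAMETER — `T i` = the lawpoints of the tame class all of whose
corner pairs have a free flat stretch of length `≥ ρ₀ − c·i` in a neighbouring gap (HOME `FINDING-BSPAN-ROUTE-DECISION.md` §4): an expansion consumes a bounded amount of room,
so members of `T i` expand into `T (i+1)`, but only while `ρ₀ − c·i` stays above the room one configuration needs — for `i ≤ N`, not for every `i`. The proof of the nested
criterion uses the expansion hypothesis only at the index `i ≤ finrank` where the monotone chain of spans stabilises; this file records the criterion with the hypothesis
restricted to `i ≤ N` for any `N` bounding the dimension of the planar module, which is the form the decreasing-room chain meets (choose `ρ₀ ≥ c·N + ρ_min`).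

* ★ `submodule_exists_stable_of_monotone_le` — the stable member of a monotone chain needs the one-step mapping property only for `i ≤ finrank`;
* ★★★ `bNonvanish_of_finite_chain_stable_corners` / `bSpan_of_finite_chain_stable_corners'` — **THE FINITE NESTED CORNER-PAIR CRITERION**: `T` monotone, one pattern
  realised in `T 0`, `finrank ≤ N`, and for every `i ≤ N`, every corner pair `j ≤ 2m−1` and every `z ∈ T i`, `e_j (lawLP z) ∈ span (lawLP (T (i+1)))` ⇒ `BNonvanish (2m+1)`
  on the home arc, `BSpan ∧ BNonvanish` on every arc;
* ★★★ `bNonvanish_of_finite_chain_capIns` / `bSpan_of_finite_chain_capIns'` — the same with the one-step stability delivered by F2 and cap data (as in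
  `bNonvanish_of_nested_capIns`), again only for `i ≤ N`.

## References
* M. Khristoforov, S. Smirnov, *Percolation and O(1) loop model*, arXiv:2111.15612 (2021), §1.2 (arXiv v1 p. 2), §2 eq. (4) and Remark 6 (p. 5).
* D. Ridout, Y. Saint-Aubin, *Standard modules, induction and the structure of the Temperley–Lieb algebra*, Adv. Theor. Math. Phys. 18 (2014) = arXiv:1204.4505, §3
  Prop. 3.3 (arXiv p. 13) (cyclicity of the standard module under the `e_j`).
* P. A. Pearce, V. Rittenberg, J. de Gier, B. Nienhuis, *Temperley–Lieb stochastic processes*, J. Phys. A 35 (2002) L661–L668, §2 (the monoid move `e_j`; cup–cap).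

## Mathlib / tree
Tree: `MarkedLoopBoundarySpanNested` (`submodule_exists_succ_eq_of_monotone`, `span_lawLP_mono`), `MarkedLoopBoundarySpanSideways` (`bNonvanish_of_subfamily_stable_corners`),
`MarkedLoopBoundarySpanCapIns` (`tlL_one_mem_of_capInsL_mem`), `MarkedLoopBoundarySpan` (`ArcPoint`, `BSpan`, `BNonvanish`, `bSpan_iff_bNonvanish`, `bNonvanish_iff`),
`MarkedLoopBoundaryLawModule` (`lawLP`), `LatticeModels/TemperleyLiebCapContract` (`tlL`, `capInsL`, `contractL`). Mathlib: `Submodule.map_span_le`, `Submodule.span_induction`,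
`Submodule.mem_map_of_mem`.
-/

open Finset

namespace Literature.Probability.Percolation.MarkedLoops

/-! ### Linear algebra: the one-step mapping property is needed only up to the dimension -/

section LinearAlgebra

variable {K : Type*} [DivisionRing K] {V : Type*} [AddCommGroup V] [Module K V] [FiniteDimensional K V]

/-- ★ **a monotone chain mapped one step up by a family of linear maps, FOR INDICES UP TO THE DIMENSION, has a stable member within `finrank` steps** (the member where two
consecutive spans coincide; cf. `submodule_exists_stable_of_monotone`, which asks the mapping property for every index).
[cite: RidoutSaintAubin2014TL, §3 Prop. 3.3 (arXiv p. 13); lane plumbing] -/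
theorem submodule_exists_stable_of_monotone_le {ι : Type*} (W : ℕ → Submodule K V) (hW : Monotone W) (f : ι → V →ₗ[K] V)
    (hf : ∀ i ≤ Module.finrank K V, ∀ j, (W i).map (f j) ≤ W (i + 1)) : ∃ i ≤ Module.finrank K V, ∀ j, (W i).map (f j) ≤ W i := by
  obtain ⟨i, hi, he⟩ := submodule_exists_succ_eq_of_monotone W hW
  exact ⟨i, hi, fun j => he ▸ (he ▸ hf i hi j : (W i).map (f j) ≤ W (i + 1))⟩

end LinearAlgebra

open Literature.Probability.Percolation Literature.Probability.LatticeModels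
open Literature.Probability.LatticeModels.TemperleyLieb
open TriMarkedDomain

/-! ### The finite nested corner-pair criterion -/

section Finite

variable {m : ℕ}

/-- ★★★ **THE FINITE NESTED CORNER-PAIR CRITERION.** Let `T 0 ⊆ T 1 ⊆ ⋯` be families of home-arc lawpoints of `(2m+1)`-marked domains with one pattern realised at a member of
`T 0`, and let `N` bound the dimension of the planar module of `2m+2` sites. If for every `i ≤ N`, every corner pair `j ≤ 2m−1` and every `z ∈ T i` the vector `e_j (lawLP z)`
lies in the span of the laws of `T (i+1)`, then `BNonvanish (2m+1)` holds on the home arc. (Families beyond index `N` are never inspected: the monotone chain of spans has two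
equal consecutive members at some `i ≤ finrank ≤ N`, and that span is stable under every `e_j` and contains a vector of non-zero total mass.)
[cite: KhristoforovSmirnov2021, §2 eq. (4) and Remark 6 (arXiv v1 p. 5); RidoutSaintAubin2014TL, §3 Prop. 3.3 (arXiv p. 13); PearceRittenbergDeGierNienhuis2002, §2] -/
theorem bNonvanish_of_finite_chain_stable_corners (T : ℕ → Set (Σ D : TriMarkedDomain (2 * m + 1), ArcPoint D (Fin.last (2 * m)))) (hmono : Monotone T)
    (N : ℕ) (hN : Module.finrank ℂ (LinkPattern (2 * m + 1 + 1) →₀ ℂ) ≤ N)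
    (hstep : ∀ i ≤ N, ∀ (j : Fin (2 * m + 1)), j.val < 2 * m → ∀ zz : T i,
      tlL ℂ 1 j (lawLP zz.1.2) ∈ Submodule.span ℂ (Set.range fun ww : T (i + 1) => lawLP ww.1.2))
    (h0 : ∃ zz : T 0, ∃ q : Pat₀ (2 * m + 1), patternCount zz.1.1 zz.1.2.v zz.1.2.i q.1 ≠ 0) :
    BNonvanish (2 * m + 1) (Fin.last (2 * m)) := by
  set W : ℕ → Submodule ℂ (LinkPattern (2 * m + 1 + 1) →₀ ℂ) := fun i => Submodule.span ℂ (Set.range fun ww : T i => lawLP ww.1.2) with hW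
  have hWmono : Monotone W := fun i i' h => span_lawLP_mono (hmono h)
  classical
  let f : Fin (2 * m + 1) → (LinkPattern (2 * m + 1 + 1) →₀ ℂ) →ₗ[ℂ] (LinkPattern (2 * m + 1 + 1) →₀ ℂ) := fun j => if j.val < 2 * m then tlL ℂ 1 j else 0
  have hf : ∀ i ≤ Module.finrank ℂ (LinkPattern (2 * m + 1 + 1) →₀ ℂ), ∀ j, (W i).map (f j) ≤ W (i + 1) := by
    intro i hi j
    by_cases hj : j.val < 2 * m
    · simp only [f, if_pos hj]
      rw [Submodule.map_span_le]
      rintro _ ⟨zz, rfl⟩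
      exact hstep i (hi.trans hN) j hj zz
    · simp only [f, if_neg hj, Submodule.map_zero]
      exact bot_le
  obtain ⟨i, -, hstab⟩ := submodule_exists_stable_of_monotone_le W hWmono f hf
  refine bNonvanish_of_subfamily_stable_corners (T i) (fun j hj zz => ?_) ?_
  · have h := hstab j
    simp only [f, if_pos hj] at h
    exact h (Submodule.mem_map_of_mem (Submodule.subset_span ⟨zz, rfl⟩))
  · obtain ⟨zz, q, hq⟩ := h0
    exact ⟨⟨zz.1, hmono (Nat.zero_le i) zz.2⟩, q, hq⟩

/-- ★★★ **… and boundary span on EVERY arc** (`k = 2m+3 ≥ 3`). [cite: KhristoforovSmirnov2021, §1.2 (arXiv v1 p. 2: cyclic indexing); §2 eq. (4) (p. 5); RidoutSaintAubin2014TL, §3 Prop. 3.3 (arXiv p. 13)] -/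
theorem bSpan_of_finite_chain_stable_corners' {m : ℕ} (T : ℕ → Set (Σ D : TriMarkedDomain (2 * (m + 1) + 1), ArcPoint D (Fin.last (2 * (m + 1))))) (hmono : Monotone T)
    (N : ℕ) (hN : Module.finrank ℂ (LinkPattern (2 * (m + 1) + 1 + 1) →₀ ℂ) ≤ N)
    (hstep : ∀ i ≤ N, ∀ (j : Fin (2 * (m + 1) + 1)), j.val < 2 * (m + 1) → ∀ zz : T i,
      tlL ℂ 1 j (lawLP zz.1.2) ∈ Submodule.span ℂ (Set.range fun ww : T (i + 1) => lawLP ww.1.2))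
    (h0 : ∃ zz : T 0, ∃ q : Pat₀ (2 * (m + 1) + 1), patternCount zz.1.1 zz.1.2.v zz.1.2.i q.1 ≠ 0)
    (a : Fin (2 * (m + 1) + 1)) : BSpan (2 * (m + 1) + 1) a ∧ BNonvanish (2 * (m + 1) + 1) a := by
  have h := bNonvanish_of_finite_chain_stable_corners T hmono N hN hstep h0
  have ha : BNonvanish (2 * (m + 1) + 1) a := (bNonvanish_iff (n := 2 * m + 1) a (Fin.last (2 * (m + 1)))).2 h
  exact ⟨(bSpan_iff_bNonvanish a).2 ha, ha⟩

/-! ### The finite criterion with F2 and cap data -/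

/-- ★★★ **FINITE NESTED ASSEMBLY WITH F2 AND CAP DATA.** `T 0 ⊆ T 1 ⊆ ⋯` families of home-arc lawpoints with one realised pattern in `T 0`, `finrank ≤ N`; suppose that for
every `i ≤ N`, every corner pair `j ≤ 2m−1` and every `z ∈ T i` the law `lawLP z` lies in the span of the laws of those `w ∈ T (i+1)` admitting `X₀, X₁` with
`contractL j (lawLP w) = X₁ − X₀` (F2) and `capInsL j X₀, capInsL j X₁ ∈ span (lawLP (T (i+1)))` (any cap identity). Then `BNonvanish (2m+1)` on the home arc.
[cite: KhristoforovSmirnov2021, §2 eq. (4) and Remark 6 (arXiv v1 p. 5); RidoutSaintAubin2014TL, §3 Prop. 3.3 (arXiv p. 13); PearceRittenbergDeGierNienhuis2002, §2 ((monoid): `e_j` = cup–cap)] -/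
theorem bNonvanish_of_finite_chain_capIns (T : ℕ → Set (Σ D : TriMarkedDomain (2 * m + 1), ArcPoint D (Fin.last (2 * m)))) (hmono : Monotone T)
    (N : ℕ) (hN : Module.finrank ℂ (LinkPattern (2 * m + 1 + 1) →₀ ℂ) ≤ N)
    (h0 : ∃ zz : T 0, ∃ q : Pat₀ (2 * m + 1), patternCount zz.1.1 zz.1.2.v zz.1.2.i q.1 ≠ 0)
    (htight : ∀ i ≤ N, ∀ (j : Fin (2 * m + 1)), j.val < 2 * m → ∀ zz : T i,
      lawLP zz.1.2 ∈ Submodule.span ℂ (Set.range fun ww : {ww : T (i + 1) //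
          ∃ (X₀ X₁ : LinkPattern (2 * m) →₀ ℂ), contractL ℂ j (lawLP ww.1.2) = X₁ - X₀ ∧
            capInsL ℂ j X₀ ∈ Submodule.span ℂ (Set.range fun vv : T (i + 1) => lawLP vv.1.2) ∧
              capInsL ℂ j X₁ ∈ Submodule.span ℂ (Set.range fun vv : T (i + 1) => lawLP vv.1.2)} => lawLP ww.1.1.2)) :
    BNonvanish (2 * m + 1) (Fin.last (2 * m)) := by
  refine bNonvanish_of_finite_chain_stable_corners T hmono N hN (fun i hi j hj zz => ?_) h0
  set W := Submodule.span ℂ (Set.range fun ww : T (i + 1) => lawLP ww.1.2) with hW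
  have key : ∀ x, x ∈ Submodule.span ℂ (Set.range fun ww : {ww : T (i + 1) //
      ∃ (X₀ X₁ : LinkPattern (2 * m) →₀ ℂ), contractL ℂ j (lawLP ww.1.2) = X₁ - X₀ ∧
        capInsL ℂ j X₀ ∈ Submodule.span ℂ (Set.range fun vv : T (i + 1) => lawLP vv.1.2) ∧
          capInsL ℂ j X₁ ∈ Submodule.span ℂ (Set.range fun vv : T (i + 1) => lawLP vv.1.2)} => lawLP ww.1.1.2) → tlL ℂ 1 j x ∈ W := by
    intro x hx
    refine Submodule.span_induction ?_ ?_ ?_ ?_ hx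
    · rintro _ ⟨⟨ww, X₀, X₁, hF2, hX₀, hX₁⟩, rfl⟩
      exact tlL_one_mem_of_capInsL_mem j hF2 hX₀ hX₁
    · rw [map_zero]; exact W.zero_mem
    · intro x y _ _ hx hy; rw [map_add]; exact W.add_mem hx hy
    · intro c x _ hx; rw [map_smul]; exact W.smul_mem c hx
  exact key _ (htight i hi j hj zz)

/-- ★★★ **… and boundary span on EVERY arc** (`k = 2m+3 ≥ 3`). [cite: KhristoforovSmirnov2021, §1.2 (arXiv v1 p. 2: cyclic indexing); §2 eq. (4) (p. 5); RidoutSaintAubin2014TL, §3 Prop. 3.3 (arXiv p. 13)] -/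
theorem bSpan_of_finite_chain_capIns' {m : ℕ} (T : ℕ → Set (Σ D : TriMarkedDomain (2 * (m + 1) + 1), ArcPoint D (Fin.last (2 * (m + 1))))) (hmono : Monotone T)
    (N : ℕ) (hN : Module.finrank ℂ (LinkPattern (2 * (m + 1) + 1 + 1) →₀ ℂ) ≤ N)
    (h0 : ∃ zz : T 0, ∃ q : Pat₀ (2 * (m + 1) + 1), patternCount zz.1.1 zz.1.2.v zz.1.2.i q.1 ≠ 0)
    (htight : ∀ i ≤ N, ∀ (j : Fin (2 * (m + 1) + 1)), j.val < 2 * (m + 1) → ∀ zz : T i,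
      lawLP zz.1.2 ∈ Submodule.span ℂ (Set.range fun ww : {ww : T (i + 1) //
          ∃ (X₀ X₁ : LinkPattern (2 * (m + 1)) →₀ ℂ), contractL ℂ j (lawLP ww.1.2) = X₁ - X₀ ∧
            capInsL ℂ j X₀ ∈ Submodule.span ℂ (Set.range fun vv : T (i + 1) => lawLP vv.1.2) ∧
              capInsL ℂ j X₁ ∈ Submodule.span ℂ (Set.range fun vv : T (i + 1) => lawLP vv.1.2)} => lawLP ww.1.1.2))
    (a : Fin (2 * (m + 1) + 1)) : BSpan (2 * (m + 1) + 1) a ∧ BNonvanish (2 * (m + 1) + 1) a := by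
  have h := bNonvanish_of_finite_chain_capIns T hmono N hN h0 htight
  have ha : BNonvanish (2 * (m + 1) + 1) a := (bNonvanish_iff (n := 2 * m + 1) a (Fin.last (2 * (m + 1)))).2 h
  exact ⟨(bSpan_iff_bNonvanish a).2 ha, ha⟩

/-- ★ **the truncated chain**: a finite list of families `T 0 ⊆ ⋯ ⊆ T N` extended constantly (`T i := T (min i N)`) is monotone — the form in which a decreasing-room chain
`ρ_i = ρ₀ − c · min i N` is fed to the criteria above. [cite: RidoutSaintAubin2014TL, §3 Prop. 3.3 (arXiv p. 13); lane plumbing] -/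
theorem monotone_truncate {α : Type*} (T : ℕ → Set α) (N : ℕ) (hT : ∀ i < N, T i ⊆ T (i + 1)) : Monotone fun i => T (min i N) := by
  refine monotone_nat_of_le_succ fun i => ?_
  by_cases h : i < N
  · have h1 : min i N = i := Nat.min_eq_left h.le
    have h2 : min (i + 1) N = i + 1 := Nat.min_eq_left h
    rw [h1, h2]; exact hT i h
  · have h1 : min i N = N := Nat.min_eq_right (not_lt.1 h)
    have h2 : min (i + 1) N = N := Nat.min_eq_right ((not_lt.1 h).trans (Nat.le_succ i))
    rw [h1, h2]

end Finite

end Literature.Probability.Percolation.MarkedLoops
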